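import Summits.QuantumFields.YangMills.Theorems.LuscherReductionTwistedTraceScalingFPWeightEquivariance
import HarnessLib

/-!
# (N3) part 2 — an additive functional of the base point invariant under global colour rotations VANISHES: `1 + Ad(i) + Ad(j) + Ad(k) = 0` on every colour vector
# (lane A of S-BASE, crux `TwistedTraceScaling` stmt-QuantumFields-20203, C4 INNER; design note `pub/ym-fleet/ym-luscher-20007-p1/COARSE-DESIGN.md` §23.11 (N3))

The derivative at the vacuum base point of any `Ad`-invariant function of the base point `p = (w, c)` is an `Ad`-invariant LINEAR functional; THIS FILE shows such functionals
vanish, with a two-line mechanism: the three unit quaternions `P(e_b)` (`b = 0,1,2`) act by the rotations `Ad(P(e_b)) = diag(±1)` with `+1` exactly in slot `b`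
(★ `adRot_chartSU2_single`), so ★ `sum_adRot_single`: `1 + Σ_b Ad(P(e_b)) = 0` as `3×3` matrices; hence for every additive `ℓ` on base points (or on any space on which `SU(2)` acts
colour-vector-wise) with `ℓ ∘ Ad_g = ℓ`: `4ℓ(p) = ℓ(p + Σ_b Ad_{P(e_b)} p) = ℓ(0) = 0` — ★★ `eq_zero_of_adParamL_invariant` (base points), `eq_zero_of_adRot_invariant` (one colour vector).
HONEST FRAMING: linear algebra for a stub of a child of the CONDITIONAL reduction route R2b1; no spectral claim; C4 OPEN; not a gap, not Clay.
-/

set_option autoImplicit false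

noncomputable section

open Real
open scoped BigOperators Matrix Quaternion
open Literature.MathematicalPhysics.QuantumFieldTheory
open Literature.MathematicalPhysics.QuantumLattice

namespace Summit.QuantumFields.YangMills.Theorems.FemtoTransferGap.TwoLattice.ConstTube

open Summit.QuantumFields.YangMills.Theorems.FemtoTransferGap

/-! ## §1 The three π-rotations -/

/-- `Ad(V)` from the quaternion components of `V`. [cite: BrockerTomDieck1985, I (1.10)] -/
theorem adRot_eq_of_su2Quat (V : SU2) (p q r s : ℝ) (h : su2Quat V = ⟨p, q, r, s⟩) :
    adRot V = !![p ^ 2 + q ^ 2 - r ^ 2 - s ^ 2, 2 * (q * r - p * s), 2 * (q * s + p * r);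
      2 * (q * r + p * s), p ^ 2 - q ^ 2 + r ^ 2 - s ^ 2, 2 * (r * s - p * q);
      2 * (q * s - p * r), 2 * (p * q + r * s), p ^ 2 - q ^ 2 - r ^ 2 + s ^ 2] := by
  have e1 : ((V : Matrix (Fin 2) (Fin 2) ℂ) 0 0).re = p := by rw [show ((V : Matrix (Fin 2) (Fin 2) ℂ) 0 0).re = (su2Quat V).re from rfl, h]
  have e2 : ((V : Matrix (Fin 2) (Fin 2) ℂ) 0 0).im = q := by rw [show ((V : Matrix (Fin 2) (Fin 2) ℂ) 0 0).im = (su2Quat V).imI from rfl, h]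
  have e3 : ((V : Matrix (Fin 2) (Fin 2) ℂ) 0 1).re = r := by rw [show ((V : Matrix (Fin 2) (Fin 2) ℂ) 0 1).re = (su2Quat V).imJ from rfl, h]
  have e4 : ((V : Matrix (Fin 2) (Fin 2) ℂ) 0 1).im = s := by rw [show ((V : Matrix (Fin 2) (Fin 2) ℂ) 0 1).im = (su2Quat V).imK from rfl, h]
  unfold adRot
  simp only [e1, e2, e3, e4]

/-- The quaternion of `P(e_b)` is the unit `b`. [folklore] -/
theorem su2Quat_chartSU2_single (b : Fin 3) :
    su2Quat (chartSU2 (Pi.single b (1 : ℝ))) = ⟨0, (Pi.single b (1 : ℝ) : Fin 3 → ℝ) 0, (Pi.single b (1 : ℝ) : Fin 3 → ℝ) 1, (Pi.single b (1 : ℝ) : Fin 3 → ℝ) 2⟩ := by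
  have hs : ∑ a, (Pi.single b (1 : ℝ) : Fin 3 → ℝ) a ^ 2 = 1 := by
    fin_cases b <;> simp [Pi.single_apply]
  rw [su2Quat_chartSU2 (by rw [hs]), quatChart, hs, sub_self, Real.sqrt_zero]

/-- ★ `Ad(P(e_b)) = diag(a ↦ if a = b then 1 else −1)` — the rotation by `π` about the axis `b`. [folklore] -/
theorem adRot_chartSU2_single (b : Fin 3) : adRot (chartSU2 (Pi.single b (1 : ℝ))) = Matrix.diagonal fun a => if a = b then (1 : ℝ) else -1 := by
  rw [adRot_eq_of_su2Quat _ 0 ((Pi.single b (1 : ℝ) : Fin 3 → ℝ) 0) ((Pi.single b (1 : ℝ) : Fin 3 → ℝ) 1) ((Pi.single b (1 : ℝ) : Fin 3 → ℝ) 2)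
    (su2Quat_chartSU2_single b)]
  ext i j
  fin_cases b <;> fin_cases i <;> fin_cases j <;> simp [Matrix.diagonal]

/-- ★ **`v + Σ_b Ad(P(e_b)) v = 0`** for every colour vector `v`. [folklore] -/
theorem sum_adRot_single_mulVec (v : Fin 3 → ℝ) : v + ∑ b : Fin 3, (adRot (chartSU2 (Pi.single b (1 : ℝ)))).mulVec v = 0 := by
  funext a
  simp only [Pi.add_apply, Finset.sum_apply, Pi.zero_apply, adRot_chartSU2_single, Matrix.mulVec_diagonal]
  fin_cases a <;> simp [Fin.sum_univ_three]

/-! ## §2 ★★ Invariant additive functionals vanish -/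

/-- ★ One colour vector: an additive map `ℓ : ℝ³ → M` with `ℓ(Ad_g v) = ℓ(v)` for all `g ∈ SU(2)` vanishes. [folklore] -/
theorem eq_zero_of_adRot_invariant {M : Type*} [AddCommGroup M] [Module ℝ M] (ℓ : (Fin 3 → ℝ) →ₗ[ℝ] M)
    (h : ∀ (g : SU2) (v : Fin 3 → ℝ), ℓ ((adRot g).mulVec v) = ℓ v) (v : Fin 3 → ℝ) : ℓ v = 0 := by
  have hsum := congrArg ℓ (sum_adRot_single_mulVec v)
  rw [map_add, map_sum, map_zero] at hsum
  simp only [h] at hsum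
  rw [Finset.sum_const, Finset.card_univ, Fintype.card_fin] at hsum
  -- `ℓ v + 3 • ℓ v = 0`
  have h4 : (4 : ℝ) • ℓ v = 0 := by
    rw [show (4 : ℝ) • ℓ v = ℓ v + (3 : ℕ) • ℓ v by rw [show (4 : ℝ) = 1 + 3 by norm_num, add_smul, one_smul]; norm_cast]
    exact hsum
  exact (smul_eq_zero.mp h4).resolve_left (by norm_num)

variable (L : ℕ) [NeZero L]

/-- ★ `p + Σ_b Ad_{P(e_b)} p = 0` for every base point `p = (w, c)`. [folklore] -/
theorem sum_adParamL_single (p : balancedSubmodule L × (Fin 3 → Fin 3 → ℝ)) :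
    p + ∑ b : Fin 3, adParamL L (chartSU2 (Pi.single b (1 : ℝ))) p = 0 := by
  refine Prod.ext (Subtype.ext (funext fun e => ?_)) (funext fun k => ?_)
  · have h := sum_adRot_single_mulVec ((p.1 : Edge 3 L → Fin 3 → ℝ) e)
    rw [Prod.fst_add, Prod.fst_sum, Submodule.coe_add, Submodule.coe_sum, Pi.add_apply, Finset.sum_apply]
    simp only [adParamL_fst]
    exact h
  · have h := sum_adRot_single_mulVec (p.2 k)
    rw [Prod.snd_add, Prod.snd_sum, Pi.add_apply, Finset.sum_apply]
    simp only [adParamL_snd]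
    exact h

/-- ★★ **AN `Ad`-INVARIANT LINEAR FUNCTIONAL OF THE BASE POINT VANISHES**: `ℓ ∘ adParamL g = ℓ` for all `g` ⇒ `ℓ = 0`. [folklore] -/
theorem eq_zero_of_adParamL_invariant {M : Type*} [AddCommGroup M] [Module ℝ M] (ℓ : (balancedSubmodule L × (Fin 3 → Fin 3 → ℝ)) →ₗ[ℝ] M)
    (h : ∀ (g : SU2) (p : balancedSubmodule L × (Fin 3 → Fin 3 → ℝ)), ℓ (adParamL L g p) = ℓ p) : ℓ = 0 := by
  refine LinearMap.ext fun p => ?_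
  have hsum := congrArg ℓ (sum_adParamL_single L p)
  rw [map_add, map_sum, map_zero] at hsum
  simp only [h] at hsum
  rw [Finset.sum_const, Finset.card_univ, Fintype.card_fin] at hsum
  have h4 : (4 : ℝ) • ℓ p = 0 := by
    rw [show (4 : ℝ) • ℓ p = ℓ p + (3 : ℕ) • ℓ p by rw [show (4 : ℝ) = 1 + 3 by norm_num, add_smul, one_smul]; norm_cast]
    exact hsum
  rw [LinearMap.zero_apply]
  exact (smul_eq_zero.mp h4).resolve_left (by norm_num)

/-- The same for a continuous linear functional. [folklore] -/
theorem eq_zero_of_adParamL_invariant' {M : Type*} [NormedAddCommGroup M] [NormedSpace ℝ M] (ℓ : (balancedSubmodule L × (Fin 3 → Fin 3 → ℝ)) →L[ℝ] M)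
    (h : ∀ (g : SU2) (p : balancedSubmodule L × (Fin 3 → Fin 3 → ℝ)), ℓ (adParamL L g p) = ℓ p) : ℓ = 0 := by
  have h1 := eq_zero_of_adParamL_invariant L (ℓ : (balancedSubmodule L × (Fin 3 → Fin 3 → ℝ)) →ₗ[ℝ] M) h
  refine ContinuousLinearMap.ext fun p => ?_
  have := congrArg (fun f : (balancedSubmodule L × (Fin 3 → Fin 3 → ℝ)) →ₗ[ℝ] M => f p) h1
  simpa using this

end Summit.QuantumFields.YangMills.Theorems.FemtoTransferGap.TwoLattice.ConstTube

end
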